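import Literature.Barriers.QuantumFields.FiniteTemperatureInfraredExplicitProofs
import HarnessLib

/-!
# Borgs–Seiler's deconfinement theorem at every lattice temperature: discharge of the
# catalogued fact `FiniteTemperatureDeconfinement` and of `BorgsSeilerInfraredBound`

This file only composes results already in the tree (no definitions, no named facts):

* `Literature.Barriers.QuantumFields.BorgsSeilerInfraredBoundExplicit_holds`
  (`FiniteTemperatureInfraredExplicitProofs`) — Borgs–Seiler's infrared bound for Polyakov loops
  with the printed rate `f(J_E) = (1 + 2J_E⁻¹χ(1))^{L₀} − 1`, Lemma III.6 / Cor. III.7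
  (pp. 348–349), for every compact `G` with a continuous unitary representation;
* `BorgsSeilerInfraredBound.of_explicit` (`FiniteTemperatureInfraredExplicit`) — its
  specialisation to the fundamental representations of `U(N)` and `SU(N)`;
* `BorgsSeilerPolyakovDiagonal_holds` (`FiniteTemperaturePolyakovDiagonal`) — the diagonal bound
  `G(0) = ⟨|Tr u|²⟩ ≥ 1`, (III.18)/(III.23), by reflection positivity in the time direction;
* `FiniteTemperatureDeconfinement.of_infraredBound` (`FiniteTemperatureDeconfinementInfrared`) —
  the printed assembly of Cor. III.5 / Thm III.7 (spectral sum rule, `∫ dp/E(p) = I(d) < ∞` iff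
  `d ≥ 3`, mass at `p = 0`, long-range order).

Hence the two remaining named facts of the finite-temperature deconfinement story are theorems:
`BorgsSeilerInfraredBound_holds` (Lemma III.6 / Cor. III.7 in the existential form of
`FiniteTemperatureDeconfinementInfrared`) and `FiniteTemperatureDeconfinement_holds` (Thm III.7:
Polyakov long-range order for `U(N)`, `N ≥ 1`, and `SU(N)`, `N ≥ 2`, `d ≥ 3`, every temporal
extent `L₀ ≥ 1`, all `J_E ≥ J₀(N, d, L₀)` and all `J_M > 0`). In particular every consequence of the
barrier stated in `FiniteTemperatureDeconfinement` under the hypothesis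
`(h : FiniteTemperatureDeconfinement)` (`.isotropic_unitary`, `.not_polyakovConfinementAtAllCouplings_…`,
`.not_uniformClusteringAtAllCouplings_…`, `.not_temperatureBlind…`) now holds unconditionally, at
every single temporal extent `L₀` (the one-layer case `L₀ = 1` was already unconditional:
`FiniteTemperatureOneLayerInfrared`); the last section records these unconditional barrier
theorems under the names `…_holds` (first landed by the review-split seat's version of this file,
p63687, which the discharge proposal p63693 — prepared concurrently as a new file — replaced;
restored here with the same names, signatures and cites).

## References

* C. Borgs, E. Seiler, *Lattice Yang–Mills theory at nonzero temperature and the confinement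
  problem*, Commun. Math. Phys. 91 (1983) 329–380: §III.1 Cor. III.5 (p. 347), (III.18)/(III.23)
  (p. 347); §III.2 Lemma III.6 (III.29)–(III.30), Cor. III.7 (III.31) (pp. 348–349), Thm III.7
  (III.62)–(III.65) (pp. 353–354). [BorgsSeiler1983]
-/

noncomputable section

namespace Literature.Barriers.QuantumFields

/-- **Borgs–Seiler's infrared bound `BorgsSeilerInfraredBound` holds** (Lemma III.6 / Cor. III.7 for
the fundamental representations of `U(N)`, `N ≥ 1`, and `SU(N)`, `N ≥ 2`, every `d`, every `L₀ ≥ 1`,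
with some rate `f(J_E) → 0`): the explicit bound `BorgsSeilerInfraredBoundExplicit_holds` with the
printed rate `f = borgsSeilerRate N L₀ = (1 + 2N/J_E)^{L₀} − 1`, specialised by
`BorgsSeilerInfraredBound.of_explicit`.
[cite: BorgsSeiler1983, §III.2 Lemma III.6 (III.29)–(III.30), Cor. III.7 (III.31) (pp. 348–349)] -/
theorem BorgsSeilerInfraredBound_holds : BorgsSeilerInfraredBound :=
  BorgsSeilerInfraredBound.of_explicit BorgsSeilerInfraredBoundExplicit_holds

/-- **Borgs–Seiler's deconfinement theorem `FiniteTemperatureDeconfinement` holds** (Thm III.7 with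
Cor. III.5: for `U(N)`, `N ≥ 1`, and `SU(N)`, `N ≥ 2`, in `d ≥ 3` space dimensions and at every
temporal extent `L₀ ≥ 1` there is `J₀` such that the Polyakov loops have long-range order for all
`J_E ≥ J₀` and all `J_M > 0`): the printed assembly `FiniteTemperatureDeconfinement.of_infraredBound`
fed with the two estimates, now both theorems — the infrared bound `BorgsSeilerInfraredBound_holds`
and the diagonal bound `BorgsSeilerPolyakovDiagonal_holds`.
[cite: BorgsSeiler1983, §III.2 Thm III.7 (III.62)–(III.65) (pp. 353–354); §III.1 Cor. III.5 and its proof (pp. 347–348)] -/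
theorem FiniteTemperatureDeconfinement_holds : FiniteTemperatureDeconfinement :=
  FiniteTemperatureDeconfinement.of_infraredBound BorgsSeilerInfraredBound_holds
    BorgsSeilerPolyakovDiagonal_holds

/-! ### The barrier theorems, unconditionally, at every temporal extent `L₀` -/

open FiniteTemperature Literature.MathematicalPhysics.QuantumLattice

/-- **Barrier theorem, `U(N)`, at each temporal extent, unconditionally**: for `N ≥ 1`, `d ≥ 3` and
EVERY `L₀ ≥ 1`, Polyakov confinement cannot hold at all couplings on `ℤ^d × ℤ_{L₀}`
(`FiniteTemperatureDeconfinement.not_polyakovConfinementAtAllCouplings_unitary` fed with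
`FiniteTemperatureDeconfinement_holds`). [cite: BorgsSeiler1983, §III.2 Thm III.7 (p. 353); §IV (p. 357)] -/
theorem not_polyakovConfinementAtAllCouplings_unitary_holds {N d : ℕ} (hN : 1 ≤ N) (hd : 3 ≤ d)
    (L₀ : ℕ) [NeZero L₀] : ¬ PolyakovConfinementAtAllCouplings d L₀ (unitaryFundamentalRep (Fin N) ℂ) :=
  FiniteTemperatureDeconfinement_holds.not_polyakovConfinementAtAllCouplings_unitary hN hd L₀

/-- **Barrier theorem, `SU(N)`, at each temporal extent, unconditionally** (`N ≥ 2`, `d ≥ 3`,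
every `L₀`). [cite: BorgsSeiler1983, §III.2 Thm III.7 (p. 353); §IV (p. 357)] -/
theorem not_polyakovConfinementAtAllCouplings_specialUnitary_holds {N d : ℕ} (hN : 2 ≤ N)
    (hd : 3 ≤ d) (L₀ : ℕ) [NeZero L₀] :
    ¬ PolyakovConfinementAtAllCouplings d L₀ (fundamentalRep (Fin N)) :=
  FiniteTemperatureDeconfinement_holds.not_polyakovConfinementAtAllCouplings_specialUnitary hN hd L₀

/-- **No volume-uniform exponential clustering of the Polyakov correlation at all couplings, at any
fixed temporal extent, `U(N)`, unconditionally** (the finite-volume shape delivered by convergent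
strong-coupling expansions, which hold "Irrespective of `J_M` and temperature" only at small `J_E`).
[cite: BorgsSeiler1983, §III.2 Thm III.7 (p. 353); §II.4 (II.55)–(II.56) (p. 343)] -/
theorem not_uniformClusteringAtAllCouplings_unitary_holds {N d : ℕ} (hN : 1 ≤ N) (hd : 3 ≤ d)
    (L₀ : ℕ) [NeZero L₀] : ¬ UniformClusteringAtAllCouplings d L₀ (unitaryFundamentalRep (Fin N) ℂ) :=
  FiniteTemperatureDeconfinement_holds.not_uniformClusteringAtAllCouplings_unitary hN hd L₀

/-- **… and for `SU(N)`, unconditionally.** [cite: BorgsSeiler1983, §III.2 Thm III.7 (p. 353); §II.4 (II.55)–(II.56) (p. 343)] -/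
theorem not_uniformClusteringAtAllCouplings_specialUnitary_holds {N d : ℕ} (hN : 2 ≤ N)
    (hd : 3 ≤ d) (L₀ : ℕ) [NeZero L₀] :
    ¬ UniformClusteringAtAllCouplings d L₀ (fundamentalRep (Fin N)) :=
  FiniteTemperatureDeconfinement_holds.not_uniformClusteringAtAllCouplings_specialUnitary hN hd L₀

/-- **Isotropic Wilson action (`J_E = J_M = β`), `U(N)`, unconditionally**: for `N ≥ 1`, `d ≥ 3` and
every `L₀` there is `β₀ > 0` with Polyakov long-range order for all `β ≥ β₀`
(`FiniteTemperatureDeconfinement.isotropic_unitary`; uses that `J₀` is independent of `J_M`).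
[cite: BorgsSeiler1983, §III.2 Thm III.7 (p. 353); §IV (p. 358)] -/
theorem isotropic_unitary_holds {N d : ℕ} (hN : 1 ≤ N) (hd : 3 ≤ d) (L₀ : ℕ) [NeZero L₀] :
    ∃ β₀ : ℝ, 0 < β₀ ∧ ∀ β : ℝ, β₀ ≤ β →
      HasPolyakovLongRangeOrder d L₀ (unitaryFundamentalRep (Fin N) ℂ) β β :=
  FiniteTemperatureDeconfinement_holds.isotropic_unitary hN hd L₀

/-- **Isotropic Wilson action, `SU(N)`, `N ≥ 2`, unconditionally.** [cite: BorgsSeiler1983, §III.2 Thm III.7 (p. 353); §IV (p. 358)] -/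
theorem isotropic_specialUnitary_holds {N d : ℕ} (hN : 2 ≤ N) (hd : 3 ≤ d) (L₀ : ℕ) [NeZero L₀] :
    ∃ β₀ : ℝ, 0 < β₀ ∧ ∀ β : ℝ, β₀ ≤ β →
      HasPolyakovLongRangeOrder d L₀ (fundamentalRep (Fin N)) β β :=
  FiniteTemperatureDeconfinement_holds.isotropic_specialUnitary hN hd L₀

end Literature.Barriers.QuantumFields

end
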